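import Summits.ABC.ABC.Theses.PadicPrimesKummerThird
import Literature.Barriers.ABC.BakerMethodBoundsKummerArchProofs
import Literature.NumberTheory.Transcendental.PhilipponZeroEstimateMultidegree
import HarnessLib

/-! Post-birth import form of the registered BC3 birth skeleton (planner g6 registered
`m3hb/post/Y07Two_birth.lean`, skeleton sha a213be5b…/266d2e09…, 2026-08-26T14:19Z/14:27Z; this copy is
rebuilt by planner g7 from the cell's pre-birth record `HOME/plan-m3/bc/Y07Two_birth.lean` with the
statement block replaced by the route import — stub names and signatures unchanged). -/

/-! # Birth skeleton (BC3) for crux `Y07Two` — line `gen3-zero-estimate-end-two` (planner plan-m3 g0, 2026-08-26)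

The crux is the Yu-2007-quality `2`-adic text for sets of odd rational primes.  Same line as `Y07Odd` with the
cell's landed base-3 (`q = 3`) layer at `p = 2` (PadicTwo*, DescentIntegralityThirdQ, multicubic Liouville):
a Gen-3 engine for INTEGER principal units `≡ 1 (mod 8)` (`GenThreeEngineTwo`; the crux is its instance
`αⱼ = qⱼ²`), one external input = the shared zero estimate `Nesterenko2003_prop51` (tree named fact).  Three registered stubs:
`stub_zeroEstimate` (shared), `stub_engineTwo : Nesterenko2003_prop51 → GenThreeEngineTwo` (XL, load-bearing),
`stub_transferTwo` (M). -/

namespace Summit.ABC.ABC.Cruxes.Y07Two.Birth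

open Summit.ABC.ABC.Theses.PadicPrimesKummerThird
open Literature.NumberTheory.Transcendental Literature.NumberTheory.Transcendental.GaGm

/- v2 (2026-08-26 13:3xZ): the shared zero-estimate stub is the tree's NAMED FACT
`Literature.NumberTheory.Transcendental.Nesterenko2003_prop51` (Nesterenko 2003, Prop. 5.1 =
Waldschmidt 2000 Thm 8.1 = Philippon 1986 Thm 2.1 on `𝔾ₐ × 𝔾ₘⁿ ⊂ (ℙ¹)ⁿ⁺¹` with multiplicity `T`
along `W` and unequal Laurent multidegrees; lit g5, p447121, unproved named fact, cite-tagged) BY NAME.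
The v1 local polynomial-degree variant `PhilipponMultidegree` (record copy
`bc/Y07Two_birth.v1-1301Z.lean`; cross-read HOME/lit/SOURCES.md §18.3: v1 ⇒ named fact on `D ≥ 1, W ≠ 0`,
the converse up to `2ⁿ` and the translate clause — immaterial for Nesterenko §5.2) is RETIRED so that no
near-duplicate of a Literature decl is introduced.  Both tree parents of the fact are PROVED:
`Philippon1986_GaGm_holds` (multiplicity, `ℙ¹ × ℙᵐ`, lossy constant) and `Philippon1986_GaGm_P1n_holds`
(`(ℙ¹)ⁿ⁺¹`, `T = 0`, exact `(n+1)!`); the discharge `Nesterenko2003_prop51_holds` is their MERGE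
(`T > 0` × unequal `D_j` × general-rank minors sum). -/

/-- **Gen-3 unit-form engine text, `p = 2`** (the M2 `p = 2` engine hypotheses of
`Summit.ABC.StewartYu.YuNinetyW80.two_of_w80Engine_int'` — INTEGER principal units `αⱼ ≡ 1 (mod 8)`,
multiplicatively independent, 3-Kummer condition (base-3 descent; free for squares of primes), heights
`h(αⱼ) ≤ Vⱼ ≤ Vmax`, floor `1 ≤ Vⱼ`, `log max(3,|bⱼ|) ≤ W` — with the Gen-3 conclusion `C(m) ≤ c₁^m`, ONE
logarithm; at `p = 2` the factor `p/(log p)²` is a constant):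
`ord₂(∏ αⱼ^{bⱼ} − 1) ≤ C(m) · ∏ Vⱼ · (W + log(2Vmax))`.  [cite: Yu2007, Main Thm (K = ℚ, ℘ = 2); shape only] -/
def GenThreeEngineTwo : Prop :=
  ∃ (C : ℕ → ℝ) (c₁ : ℝ), 1 ≤ c₁ ∧ (∀ m, 0 ≤ C m ∧ C m ≤ c₁ ^ m) ∧
    ∀ (m : ℕ) (α : Fin m → ℚ) (b : Fin m → ℤ) (V : Fin m → ℝ) (Vmax W : ℝ),
      (∀ j, ∃ a : ℤ, α j = a) →
      (∀ j, 3 ≤ padicValRat 2 (α j - 1)) →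
      (∀ μ : Fin m → ℤ, ∏ j, α j ^ μ j = 1 → μ = 0) →
      (∀ κ : Fin m → ℕ, (∃ j, ¬ 3 ∣ κ j) → ∀ γ : ℚ, ∏ j, α j ^ κ j ≠ γ ^ 3) →
      (∀ j, Height.logHeight₁ (α j) ≤ V j) → (∀ j, 1 ≤ V j) → (∀ j, V j ≤ Vmax) →
      b ≠ 0 → (∀ j, Real.log (max 3 (|b j| : ℝ)) ≤ W) → 1 ≤ W →
      (padicValRat 2 (∏ j, α j ^ b j - 1) : ℝ) ≤ C m * (∏ j, V j) * (W + Real.log (2 * Vmax))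

/-- STUB (shared with the `Y07Odd` skeleton; L–XL, parents proved): the zero estimate with multiplicity
and unequal multidegrees, `Nesterenko2003_prop51` (tree named fact; discharge = merge of the proved
`Philippon1986_GaGm_holds` and `Philippon1986_GaGm_P1n_holds`). -/
theorem stub_zeroEstimate : Nesterenko2003_prop51 := by
  sorry

/-- STUB (load-bearing, XL): the Gen-3 `p`-adic engine from the zero estimate — the cell's landed
one-variable descent architecture (PadicTwist*/PadicCW77* at odd `p`, PadicTwo* at `p = 2`) with the three
Matveev/Nesterenko-2003 deltas (p2 memo-06): unknowns indexed by the height-weighted box (the lattice part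
is trivial for independent units), `n` directional Feldman Δ-weights, and the §5 zero-estimate END
(`Nesterenko2003_prop51` → obstruction subgroup `G* = V × T_Φ` → Nesterenko Lemmas 5.2–5.4 → Matveev's
sublattice, Prop. 2.6 by `Dioph.minkowski_second_core`) replacing the Vandermonde endgame; `p`-adic radii
per the K-M3.1 parameter ledger (gain `log p / 2` per zero, Yu's class count `≤ p − 1`). -/
theorem stub_engineTwo : Nesterenko2003_prop51 → GenThreeEngineTwo := by
  sorry

/-- STUB (transfer, M; pattern = the landed `Summit.ABC.StewartYu.YuNinetyW80.two_of_w80Engine_int'`):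
engine ⇒ crux.  `αⱼ = qⱼ²` (`qⱼ` odd ⇒ `qⱼ² ≡ 1 (mod 8)`, an integer), `bⱼ = e qⱼ`;
`ord₂(u − 1) ≤ ord₂(u² − 1)` for `u = ∏ q^{e_q} ≠ ±1`; squares of distinct primes are multiplicatively
independent and 3-Kummer (a cube needs `3 ∣ 2κⱼ ⇒ 3 ∣ κⱼ`); `Vⱼ = 2 log qⱼ ≥ 2 log 3 > 1`,
`Vmax = 2 log A`, `W = log B ≥ 1`; `W + log(4 log A) ≤ 3·(log 2 + log B + log log A)`; the factor `2^m`
from `∏ 2 log qⱼ` is absorbed: `c₆ = 6c₁ + 1`. -/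
def TransferTwo : Prop := GenThreeEngineTwo → Y07Two

/-- STUB (transfer, M): `TransferTwo` = engine text ⇒ crux (see the def above). -/
theorem stub_transferTwo : TransferTwo := by
  sorry

/-- BC3 composition (hypothesis form): the crux BY NAME from exactly the three stub STATEMENTS;
kernel-checked, no sorry of its own. -/
theorem Y07Two_of : Nesterenko2003_prop51 → (Nesterenko2003_prop51 → GenThreeEngineTwo) →
    TransferTwo → Y07Two :=
  fun z e t => t (e z)

/-- BC3 composition (closed form, A12 shape): the crux BY NAME with NO hypotheses, from exactly the
registered stubs. -/
theorem Y07Two_closed : Y07Two :=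
  Y07Two_of stub_zeroEstimate stub_engineTwo stub_transferTwo

end Summit.ABC.ABC.Cruxes.Y07Two.Birth
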